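import Summits.Ventures.QEC.Census.RefinedGridMoments
import HarnessLib

/-!
# Refined certificates on the evaluation grid: the TRANSFORMED point table by nested Krawtchouk transforms

Venture QEC (cell `qec`, LADDER-QEC rung X1; row 06). Second half of the re-implementation of the grid tables (first
half: `RefinedGridMoments.lean`, the plain table `TP = ptab`). The grid leaf checks also need the point sums at the
TRANSFORMED points `T p` (`tX x = (x₀+3x₁, x₀−x₁)`, `tY y = (y₀+y₁+2y₂, y₀+y₁−2y₂, y₀−y₁)`, CRSS's refined MacWilliams
transform [CalderbankEtAl1998, §7 (ii)]). On the canonical grid (`x₀ = y₀ = 1`) the transformed monomial EXPANDS in the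
plain monomials with products of one-dimensional Krawtchouk coefficients: `(1+3x₁)^{m−a}(1−x₁)^a = Σ Kx[a'] x₁^{a'}`
and `(1+j+2l)^{w−b−c}(1+j−2l)^b(1−j)^c = Σ_s K₂(w−b−c,b)[s] l^s (1+j)^{w−c−s}(1−j)^c = Σ_s Σ_r K₂[s] K(w−c−s,c)[r] j^r l^s`
(`xPart_tX_expand`, `yPart_tY_expand`, from `hev_krRow`), so the transformed table is obtained from the plain one by three
nested one-dimensional transforms (`n1vec`, `n2vec`, `ttab`; ≈ `3·10⁴` small products at `w₀ = 24`) — and we PROVE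
entry-wise equality with `gridTab … (gridX.map tX) (gridY.map tY) …` on the valid classes (`get3_ttab_ptab`,
`ttab_eq_gridTabF`, `ptab_eq_gridTabF`). The leaf check using these tables and its soundness (by implication to
`rleafOKP`) are in `RefinedPairCertificateTransform.lean`. HONEST FRAMING: pure bookkeeping about finite sums; nothing
here certifies a distance. [cite: CalderbankEtAl1998, §7 (ii) (printed p. 28)]; [cite: MacWilliamsSloane1977, Ch. 5 §7 eq. (54)].
-/

namespace Summit.Ventures.QEC.Census

open Finset Literature.InformationTheory.QuantumCodes

/-! ### 1. The transformed point table -/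

/-- Truncating dot product. Column: definition (ours). [folklore] -/
def dot (u v : List ℤ) : ℤ := (List.zipWith (· * ·) u v).sum

/-- Transpose of a `(w+1) × (w+1)` table. Column: definition (ours). [folklore] -/
def transp (w : ℕ) (T : List (List ℤ)) : List (List ℤ) := tab2 w fun (s r : ℕ) => get2 T r s

/-- First transform of one x-degree slice (given TRANSPOSED, rows `s`): `N1(s) = Σ_{r ≤ w−s} K(w−c−s, c)[r] · TP(r, s)`,
`s ≤ w − c`, with the binary Krawtchouk rows `K = krRow 1 (−1)`. Column: definition (ours). [cite: MacWilliamsSloane1977, Ch. 5 §7 eq. (54)] -/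
def n1vec (w : ℕ) (TT : List (List ℤ)) (c : ℕ) : List ℤ :=
  List.zipWith dot ((List.range (w - c + 1)).map fun (s : ℕ) => krRow 1 (-1) (w - c - s) c) TT

/-- Second transform: `N2(b) = Σ_{s ≤ w−c} K₂(w−b−c, b)[s] · N1(s)`, `b ≤ w − c`, with the rows `K₂ = krRow 2 (−2)` of
`(u + 2v)^{w−b−c} (u − 2v)^b`. Column: definition (ours). [cite: MacWilliamsSloane1977, Ch. 5 §7 eq. (54)] -/
def n2vec (w : ℕ) (TT : List (List ℤ)) (c : ℕ) : List ℤ :=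
  let N1 := n1vec w TT c
  (List.range (w - c + 1)).map fun (b : ℕ) => dot (krRow 2 (-2) (w - b - c) b) N1

/-- `N2` for every `c ≤ w` (rows `c`, columns `b`) of one x-degree slice. Column: definition (ours). [folklore] -/
def n2tab (w : ℕ) (TPa : List (List ℤ)) : List (List ℤ) :=
  let TT := transp w TPa
  (List.range (w + 1)).map fun (c : ℕ) => n2vec w TT c

/-- **The transformed point table by Krawtchouk transforms**: on the valid classes (`c` even, `b + c ≤ w`)
`TT(a, b, c) = Σ_{a'} Kx(m−a, a)[a'] · N2_{a'}(c, b)` with the x-rows `Kx = krRow 3 (−1)` of `(x₀+3x₁)^{m−a}(x₀−x₁)^a`;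
`0` elsewhere. Entry-wise equal, on the valid classes, to `gridTab m w (gridX.map tX) (gridY.map tY) mus`
(`ttab_eq_gridTabF`) — the refined monomial at the TRANSFORMED point `T p` expanded in the monomials at `p`.
Column: definition (ours). [cite: CalderbankEtAl1998, §7 (ii) (printed p. 28); MacWilliamsSloane1977, Ch. 5 §7 eq. (54)] -/
def ttab (m w : ℕ) (TP : List (List (List ℤ))) : List (List (List ℤ)) :=
  let N2 := (List.range (m + 1)).map fun (a' : ℕ) => n2tab w (TP.getD a' [])
  tab3 m w fun a b c => if Odd c ∨ w < b + c then 0 else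
    (List.zipWith (fun kx N2a => kx * get2 N2a c b) (krRow 3 (-1) (m - a) a) N2).sum

/-- `dot` as an indexed sum. [folklore] -/
theorem dot_eq_sum (u v : List ℤ) (h : u.length ≤ v.length) :
    dot u v = ∑ i ∈ range u.length, u.getD i 0 * v.getD i 0 :=
  sum_zipWith_eq_sum_range (· * ·) 0 u v h

/-- The transpose has `w + 1` rows. [folklore] -/
theorem length_transp (w : ℕ) (T : List (List ℤ)) : (transp w T).length = w + 1 := by simp [transp, tab2]

/-- Row `s` of the transpose is column `s`. [folklore] -/
theorem transp_row (w : ℕ) (T : List (List ℤ)) {s : ℕ} (hs : s ≤ w) :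
    (transp w T).getD s [] = (List.range (w + 1)).map fun (r : ℕ) => get2 T r s := by
  rw [transp, tab2, getD_map_range w s _ [] hs]

/-- Entries of the first transform. [folklore] -/
theorem getD_n1vec (w : ℕ) (TPa : List (List ℤ)) {c s : ℕ} (hc : c ≤ w) (hs : s ≤ w - c) :
    (n1vec w (transp w TPa) c).getD s 0 =
      ∑ r ∈ range (krRow 1 (-1) (w - c - s) c).length, (krRow 1 (-1) (w - c - s) c).getD r 0 * get2 TPa r s := by
  have hlenK : ((List.range (w - c + 1)).map fun (s : ℕ) => krRow 1 (-1) (w - c - s) c).length = w - c + 1 := by simp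
  have hsl : s < (n1vec w (transp w TPa) c).length := by
    rw [n1vec, List.length_zipWith, hlenK, length_transp]; omega
  rw [List.getD_eq_getElem _ _ hsl]
  simp only [n1vec, List.getElem_zipWith, List.getElem_map, List.getElem_range]
  have hrow : (transp w TPa)[s]'(by rw [length_transp]; omega) = (List.range (w + 1)).map fun (r : ℕ) => get2 TPa r s := by
    rw [← List.getD_eq_getElem _ [] (by rw [length_transp]; omega), transp_row w TPa (by omega)]
  rw [hrow, dot_eq_sum _ _ (by rw [length_krRow, List.length_map, List.length_range]; omega)]
  refine Finset.sum_congr rfl fun r hr => ?_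
  rw [length_krRow] at hr
  have hr' : r ≤ w := by have := mem_range.1 hr; omega
  rw [getD_map_range w r _ 0 hr']

/-- Length of the first transform. [folklore] -/
theorem length_n1vec (w : ℕ) (TPa : List (List ℤ)) (c : ℕ) (hc : c ≤ w) :
    (n1vec w (transp w TPa) c).length = w - c + 1 := by
  rw [n1vec, List.length_zipWith, length_transp, List.length_map, List.length_range]; omega

/-- Entries of the second transform. [folklore] -/
theorem getD_n2vec (w : ℕ) (TPa : List (List ℤ)) {c b : ℕ} (hc : c ≤ w) (hb : b ≤ w - c) :
    (n2vec w (transp w TPa) c).getD b 0 =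
      ∑ s ∈ range (krRow 2 (-2) (w - b - c) b).length,
        (krRow 2 (-2) (w - b - c) b).getD s 0 * (n1vec w (transp w TPa) c).getD s 0 := by
  rw [n2vec, getD_map_range (w - c) b _ 0 hb,
    dot_eq_sum _ _ (by rw [length_krRow, length_n1vec w TPa c hc]; omega)]

/-- Entries of the transformed table on the valid classes, as a sum over the x-row. [folklore] -/
theorem get3_ttab (m w : ℕ) (TP : List (List (List ℤ))) {a b c : ℕ} (ha : a ≤ m) (hb : b ≤ w) (hc : c ≤ w)
    (hv : ¬ (Odd c ∨ w < b + c)) :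
    get3 (ttab m w TP) a b c =
      ∑ a' ∈ range (krRow 3 (-1) (m - a) a).length,
        (krRow 3 (-1) (m - a) a).getD a' 0 * (n2vec w (transp w (TP.getD a' [])) c).getD b 0 := by
  rw [ttab, get3_tab3 m w _ ha hb hc, if_neg hv,
    sum_zipWith_eq_sum_range (fun kx N2a => kx * get2 N2a c b) [] _ _
      (by rw [length_krRow, List.length_map, List.length_range]; omega)]
  refine Finset.sum_congr rfl fun a' ha' => ?_
  rw [length_krRow] at ha'
  have ha'' : a' ≤ m := by have := mem_range.1 ha'; omega
  rw [getD_map_range m a' _ [] ha'', get2, n2tab, getD_map_range w c _ [] hc]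

/-! ### 2. Grid double sums and the two expansions -/

/-- The grid double sum `Σ_i X(x_i) · Σ_j μ_{ij} Y(y_j)` for arbitrary node weights `X`, `Y` (`gridSum` is the case
`X = xPart(·; a)`, `Y = yPart(·; b, c)`). Column: definition (ours). [folklore] -/
def GS (X : ℤ × ℤ → ℤ) (Y : ℤ × ℤ × ℤ → ℤ) (xs : List (ℤ × ℤ)) (ys : List (ℤ × ℤ × ℤ)) (mus : List (List ℤ)) : ℤ :=
  (List.zipWith (fun x mu => X x * (List.zipWith (fun y t => t * Y y) ys mu).sum) xs mus).sum

/-- `gridSum` is a `GS`. [folklore] -/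
theorem gridSum_eq_GS (m w : ℕ) (xs : List (ℤ × ℤ)) (ys : List (ℤ × ℤ × ℤ)) (mus : List (List ℤ)) (a b c : ℕ) :
    gridSum m w xs ys mus a b c = GS (fun x => xPart m x a) (fun y => yPart w y b c) xs ys mus := rfl

/-- `GS` over mapped node lists. [folklore] -/
theorem GS_map (X : ℤ × ℤ → ℤ) (Y : ℤ × ℤ × ℤ → ℤ) (f : ℤ × ℤ → ℤ × ℤ) (g : ℤ × ℤ × ℤ → ℤ × ℤ × ℤ)
    (xs : List (ℤ × ℤ)) (ys : List (ℤ × ℤ × ℤ)) (mus : List (List ℤ)) :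
    GS X Y (xs.map f) (ys.map g) mus = GS (fun x => X (f x)) (fun y => Y (g y)) xs ys mus := by
  simp only [GS, zipWith_map_left]

/-- `GS` only depends on the weights at the nodes. [folklore] -/
theorem GS_congr {X X' : ℤ × ℤ → ℤ} {Y Y' : ℤ × ℤ × ℤ → ℤ} {xs : List (ℤ × ℤ)} {ys : List (ℤ × ℤ × ℤ)}
    (mus : List (List ℤ)) (hX : ∀ x ∈ xs, X x = X' x) (hY : ∀ y ∈ ys, Y y = Y' y) :
    GS X Y xs ys mus = GS X' Y' xs ys mus := by
  unfold GS
  rw [zipWith_congr_mem _ (fun x mu => X' x * (List.zipWith (fun y t => t * Y' y) ys mu).sum) xs mus]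
  intro x hx mu _
  rw [hX x hx, zipWith_congr_mem _ (fun y t => t * Y' y) ys mu fun y hy t _ => by rw [hY y hy]]

/-- `GS` is additive in the x-weight. [folklore] -/
theorem GS_sum_X {ι : Type*} (T : Finset ι) (F : ι → ℤ × ℤ → ℤ) (Y : ℤ × ℤ × ℤ → ℤ) (xs : List (ℤ × ℤ))
    (ys : List (ℤ × ℤ × ℤ)) (mus : List (List ℤ)) :
    GS (fun x => ∑ t ∈ T, F t x) Y xs ys mus = ∑ t ∈ T, GS (F t) Y xs ys mus := by
  simp only [GS, Finset.sum_mul]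
  exact sum_zipWith_finset T (fun t x mu => F t x * (List.zipWith (fun y t => t * Y y) ys mu).sum) xs mus

/-- `GS` is homogeneous in the x-weight. [folklore] -/
theorem GS_mul_X (cst : ℤ) (X : ℤ × ℤ → ℤ) (Y : ℤ × ℤ × ℤ → ℤ) (xs : List (ℤ × ℤ)) (ys : List (ℤ × ℤ × ℤ))
    (mus : List (List ℤ)) : GS (fun x => cst * X x) Y xs ys mus = cst * GS X Y xs ys mus := by
  simp only [GS, mul_assoc]
  exact sum_zipWith_const_mul cst _ xs mus

/-- `GS` is additive in the y-weight. [folklore] -/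
theorem GS_sum_Y {ι : Type*} (T : Finset ι) (X : ℤ × ℤ → ℤ) (F : ι → ℤ × ℤ × ℤ → ℤ) (xs : List (ℤ × ℤ))
    (ys : List (ℤ × ℤ × ℤ)) (mus : List (List ℤ)) :
    GS X (fun y => ∑ t ∈ T, F t y) xs ys mus = ∑ t ∈ T, GS X (F t) xs ys mus := by
  simp only [GS]
  rw [← sum_zipWith_finset]
  refine congrArg List.sum (zipWith_congr_mem _ _ _ _ fun x _ mu _ => ?_)
  have h : (List.zipWith (fun y t => t * ∑ t' ∈ T, F t' y) ys mu).sum =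
      ∑ t' ∈ T, (List.zipWith (fun y t => t * F t' y) ys mu).sum := by
    rw [← sum_zipWith_finset]
    exact congrArg List.sum (zipWith_congr_mem _ _ _ _ fun y _ t _ => Finset.mul_sum _ _ _)
  rw [h, Finset.mul_sum]

/-- `GS` is homogeneous in the y-weight. [folklore] -/
theorem GS_mul_Y (cst : ℤ) (X : ℤ × ℤ → ℤ) (Y : ℤ × ℤ × ℤ → ℤ) (xs : List (ℤ × ℤ)) (ys : List (ℤ × ℤ × ℤ))
    (mus : List (List ℤ)) : GS X (fun y => cst * Y y) xs ys mus = cst * GS X Y xs ys mus := by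
  simp only [GS]
  rw [← sum_zipWith_const_mul]
  refine congrArg List.sum (zipWith_congr_mem _ _ _ _ fun x _ mu _ => ?_)
  have h : (List.zipWith (fun y t => t * (cst * Y y)) ys mu).sum = cst * (List.zipWith (fun y t => t * Y y) ys mu).sum := by
    rw [← sum_zipWith_const_mul]
    exact congrArg List.sum (zipWith_congr_mem _ _ _ _ fun y _ t _ => by ring)
  rw [h]
  ring

/-- **x-expansion**: `xPart(tX (1, x₁); a) = (1+3x₁)^{m−a}(1−x₁)^a = Σ_{a'} Kx(m−a, a)[a'] · xPart((1, x₁); a')`.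
Column: proved (ours). [cite: CalderbankEtAl1998, §7 (ii); MacWilliamsSloane1977, Ch. 5 §7 eq. (54)] -/
theorem xPart_tX_expand (m : ℕ) (x1 : ℤ) (a : ℕ) :
    xPart m (tX (1, x1)) a =
      ∑ a' ∈ range (krRow 3 (-1) (m - a) a).length, (krRow 3 (-1) (m - a) a).getD a' 0 * xPart m ((1 : ℤ), x1) a' := by
  have h := hev_krRow 3 (-1) 1 x1 (m - a) a
  rw [hev_eq_sum] at h
  simp only [xPart, tX, one_pow, one_mul]
  rw [show (1 : ℤ) - x1 = 1 + (-1) * x1 by ring, ← h]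
  exact Finset.sum_congr rfl fun a' _ => by simp

/-- **y-expansion**: for `b + c ≤ w`, `yPart(tY (1, j, l); b, c) = (1+j+2l)^{w−b−c} (1+j−2l)^b (1−j)^c =
Σ_s K₂(w−b−c, b)[s] · Σ_r K(w−c−s, c)[r] · yPart((1, j, l); r, s)` — two nested one-dimensional Krawtchouk expansions
(`u = 1 + j`, `v = l`, then `u = 1`, `v = j`). Column: proved (ours). [cite: CalderbankEtAl1998, §7 (ii); MacWilliamsSloane1977, Ch. 5 §7 eq. (54)] -/
theorem yPart_tY_expand (w : ℕ) (j l : ℤ) {b c : ℕ} (hbc : b + c ≤ w) :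
    yPart w (tY (1, j, l)) b c =
      ∑ s ∈ range (krRow 2 (-2) (w - b - c) b).length, (krRow 2 (-2) (w - b - c) b).getD s 0 *
        ∑ r ∈ range (krRow 1 (-1) (w - c - s) c).length,
          (krRow 1 (-1) (w - c - s) c).getD r 0 * yPart w ((1 : ℤ), j, l) r s := by
  have h1 := hev_krRow 2 (-2) (1 + j) l (w - b - c) b
  rw [hev_eq_sum, length_krRow] at h1
  simp only [yPart, tY, one_pow, one_mul]
  rw [show (1 : ℤ) + j - 2 * l = (1 + j) + (-2) * l by ring, show (1 : ℤ) + j + 2 * l = (1 + j) + 2 * l by ring, ← h1,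
    Finset.sum_mul]
  rw [length_krRow]
  refine Finset.sum_congr rfl fun s hs => ?_
  have hs' : s ≤ w - c := by have := mem_range.1 hs; omega
  have h2 := hev_krRow 1 (-1) 1 j (w - c - s) c
  rw [hev_eq_sum] at h2
  simp only [one_pow, mul_one, one_mul] at h2
  have h3 : (1 + j) ^ (w - c - s) * (1 - j) ^ c =
      ∑ r ∈ range (krRow 1 (-1) (w - c - s) c).length, (krRow 1 (-1) (w - c - s) c).getD r 0 * j ^ r := by
    rw [show (1 : ℤ) - j = 1 + (-1) * j by ring, ← h2]
  rw [show w - b - c + b + 1 - 1 - s = w - c - s by omega]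
  calc (krRow 2 (-2) (w - b - c) b).getD s 0 * (1 + j) ^ (w - c - s) * l ^ s * (1 - j) ^ c
      = (krRow 2 (-2) (w - b - c) b).getD s 0 * l ^ s * ((1 + j) ^ (w - c - s) * (1 - j) ^ c) := by ring
    _ = (krRow 2 (-2) (w - b - c) b).getD s 0 * l ^ s *
          ∑ r ∈ range (krRow 1 (-1) (w - c - s) c).length, (krRow 1 (-1) (w - c - s) c).getD r 0 * j ^ r := by
        rw [h3]
    _ = _ := by
        rw [Finset.mul_sum, Finset.mul_sum]
        exact Finset.sum_congr rfl fun r _ => by ring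

/-- x-nodes have first coordinate `1`. [folklore] -/
theorem mem_gridX {m : ℕ} {x : ℤ × ℤ} (hx : x ∈ gridX m) : ∃ x1 : ℤ, x = (1, x1) := by
  simp only [gridX, List.mem_map] at hx
  obtain ⟨i, -, rfl⟩ := hx
  exact ⟨_, rfl⟩

/-- y-nodes have first coordinate `1`. [folklore] -/
theorem mem_gridY {w : ℕ} {y : ℤ × ℤ × ℤ} (hy : y ∈ gridY w) : ∃ j l : ℤ, y = (1, j, l) := by
  simp only [gridY, List.mem_flatMap, List.mem_map, List.mem_range] at hy
  obtain ⟨j, -, l, -, rfl⟩ := hy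
  exact ⟨_, _, rfl⟩

/-- **The transformed table is the transformed grid sum** on the valid classes:
`TT(a, b, c) = Σ_i xPart(tX x_i; a) · Σ_j μ_{ij} yPart(tY y_j; b, c)` (expand both parts, exchange the finite sums, and
recognise the plain table `TP = gridSum` inside). Column: proved (ours). [cite: CalderbankEtAl1998, §7 (ii) (printed p. 28)] -/
theorem get3_ttab_ptab (m w : ℕ) (mus : List (List ℤ)) {a b c : ℕ} (ha : a ≤ m) (hb : b ≤ w) (hc : c ≤ w)
    (hv : ¬ (Odd c ∨ w < b + c)) :
    get3 (ttab m w (ptab m w mus)) a b c = gridSum m w ((gridX m).map tX) ((gridY w).map tY) mus a b c := by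
  have hbc : b + c ≤ w := by omega
  rw [get3_ttab m w _ ha hb hc hv, gridSum_eq_GS, GS_map]
  have hcongr : GS (fun x => xPart m (tX x) a) (fun y => yPart w (tY y) b c) (gridX m) (gridY w) mus =
      GS (fun (x : ℤ × ℤ) => ∑ a' ∈ range (krRow 3 (-1) (m - a) a).length,
            (krRow 3 (-1) (m - a) a).getD a' 0 * xPart m x a')
        (fun (y : ℤ × ℤ × ℤ) => ∑ s ∈ range (krRow 2 (-2) (w - b - c) b).length, (krRow 2 (-2) (w - b - c) b).getD s 0 *
          ∑ r ∈ range (krRow 1 (-1) (w - c - s) c).length, (krRow 1 (-1) (w - c - s) c).getD r 0 * yPart w y r s)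
        (gridX m) (gridY w) mus :=
    GS_congr mus (fun x hx => by obtain ⟨x1, rfl⟩ := mem_gridX hx; exact xPart_tX_expand m x1 a)
      (fun y hy => by obtain ⟨j, l, rfl⟩ := mem_gridY hy; exact yPart_tY_expand w j l hbc)
  rw [hcongr, GS_sum_X]
  refine Finset.sum_congr rfl fun a' ha' => ?_
  have ha'' : a' ≤ m := by rw [length_krRow] at ha'; have := mem_range.1 ha'; omega
  rw [getD_n2vec w _ hc (by omega)]
  simp only [GS_mul_X, GS_sum_Y, GS_mul_Y, Finset.mul_sum]
  refine Finset.sum_congr rfl fun s hs => ?_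
  have hs' : s ≤ w - c := by rw [length_krRow] at hs; have := mem_range.1 hs; omega
  rw [getD_n1vec w _ hc hs']
  simp only [Finset.mul_sum]
  refine Finset.sum_congr rfl fun r hr => ?_
  have hr' : r ≤ w := by rw [length_krRow] at hr; have := mem_range.1 hr; omega
  rw [← gridSum_eq_GS, show get2 ((ptab m w mus).getD a' []) r s = get3 (ptab m w mus) a' r s from rfl,
    get3_ptab m w mus ha'' hr' (by omega)]
  ring

/-! ### 3. Table equality on the valid box -/

/-- The plain table by moments agrees entry-wise with `gridTabF` inside the box. Column: proved (ours).
[cite: CalderbankEtAl1998, §7 (ii) (printed p. 28)] -/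
theorem ptab_eq_gridTabF (m w : ℕ) (mus : List (List ℤ)) {a b c : ℕ} (ha : a ≤ m) (hb : b ≤ w) (hc : c ≤ w) :
    get3 (ptab m w mus) a b c = get3 (gridTabF m w (gridX m) (gridY w) mus) a b c := by
  rw [get3_ptab m w mus ha hb hc, gridTabF_eq, get3_gridTab _ _ _ _ _ ha hb hc]

/-- The transformed table agrees entry-wise with the transformed `gridTabF` on the valid classes. Column: proved (ours).
[cite: CalderbankEtAl1998, §7 (ii) (printed p. 28)] -/
theorem ttab_eq_gridTabF (m w : ℕ) (mus : List (List ℤ)) {a b c : ℕ} (ha : a ≤ m) (hb : b ≤ w) (hc : c ≤ w)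
    (hv : ¬ (Odd c ∨ w < b + c)) :
    get3 (ttab m w (ptab m w mus)) a b c = get3 (gridTabF m w ((gridX m).map tX) ((gridY w).map tY) mus) a b c := by
  rw [get3_ttab_ptab m w mus ha hb hc hv, gridTabF_eq, get3_gridTab _ _ _ _ _ ha hb hc]


end Summit.Ventures.QEC.Census
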